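import Summits.QuantumFields.YangMills.Theorems.RationalShortRootRigidityDihedralChevalley
import HarnessLib

/-!
# `RationalShortRootRigidity` — Step 2 helper (m8): the Möbius top-form lemma

Helper lemma INSIDE the paper proof of crux `stmt-QuantumFields-23124` (`F4SubCurvatureDoor.RationalShortRootRigidity`,
LINE g15-A of planner ym-idea-3; prover notes HOME l15/PLANAR-LEMMA-DETAILED.md, Step (2c) «TOP PART»; free-hands menu III,
item (m8), statement typed in HOME l15/Helpers23124b.lean as `Helpers.MobiusTopForm` — proved here DEF-FREE with that body
verbatim):

**Lemma** (`mobiusTopForm`).  Let `T ∈ ℝ[x,y]` be homogeneous of degree `2k` with non-zero `x^{2k}`-coefficient, such that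
every complex root `t` of `T(t,1)` is purely imaginary, and `T` is invariant under the rotation by `120°`.  Then
`T = c·(x² + y²)^k`.

Proof.  By `MvPolynomial.funext` the invariance holds in algebraic form (`bind₁`), hence at COMPLEX points
(`MvPolynomial.aeval_bind₁`).  Let `τ(t) = T(t,1) ∈ ℝ[t]`.  If `t` is a complex root of `τ` (so `Re t = 0`), the rotated
point `(A,B) = ρ(t,1)` is a zero of `T` with `B ≠ 0` (`Re B = −1/2`), and by homogeneity (`eval_smul_of_isHomogeneous`)
`A/B` is again a root of `τ`, so `Re(A/B) = 0`; but `Re(A conj B) = (√3/4)(1 − (Im t)²)`, whence `t = ±i` — the Möbius map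
of the `120°` rotation preserves `iℝ` only at slope `±i`.  A non-zero real polynomial whose complex roots lie in `{i,−i}` is
`lc·(t²+1)ᵃ` (`eq_C_mul_X_sq_add_one_pow`: a root `z` gives the root `conj z`, so `i` is a root, `(X−i)(X+i) = X²+1`
divides over `ℂ`, hence over `ℝ` by `Polynomial.map_dvd_map`; induct on the degree).  Then `T(x,1) = lc(x²+1)ᵃ` with
`2a ≤ 2k`, homogeneity gives `T = lc·y^{2k−2a}(x²+y²)ᵃ` on `{y ≠ 0}` and hence as polynomials (`MvPolynomial.funext_set`),
and the non-vanishing `x^{2k}`-coefficient forces `a = k`.  (At `90°` the Möbius map preserves `iℝ` for every slope — the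
`B₄` loophole of `Negative/FalseWithoutF4Reflection.lean`; the angle is not generalised here.)

Mathlib + the tree helpers of `RationalShortRootRigidityDihedralChevalley.lean` (`eval_bind₁_eq`, `pt_ext`, `if_one_eq`);
THEOREMS ONLY (no definitions); no named facts; no `sorry`; default heartbeats.  Nothing about the crux 23124, the route's
rung or the Yang–Mills mass gap is proved here.  Free-hands seat `ym-line-frs-p2` g10 (announced on the owner's bus
2026-08-28T20:16Z), `--supports stmt-QuantumFields-23124`.
-/

set_option autoImplicit false

namespace Summit.QuantumFields.YangMills.Theorems.RationalShortRootRigidity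

open Polynomial
open scoped BigOperators Polynomial ComplexConjugate

/-! ## 1. Homogeneous scaling and complex evaluation -/

/-- Scaling of a homogeneous polynomial: `φ(r·v) = rⁿ·φ(v)`. [folklore] -/
theorem eval_smul_of_isHomogeneous {R σ : Type*} [CommRing R] (φ : MvPolynomial σ R) {n : ℕ}
    (hφ : φ.IsHomogeneous n) (r : R) (v : σ → R) :
    MvPolynomial.eval (r • v) φ = r ^ n * MvPolynomial.eval v φ := by
  conv_lhs => rw [φ.as_sum]
  conv_rhs => rw [φ.as_sum]
  rw [map_sum, map_sum, Finset.mul_sum]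
  refine Finset.sum_congr rfl fun d hd => ?_
  rw [MvPolynomial.eval_monomial, MvPolynomial.eval_monomial, Finsupp.prod, Finsupp.prod]
  simp only [Pi.smul_apply, smul_eq_mul, mul_pow, Finset.prod_mul_distrib, Finset.prod_pow_eq_pow_sum,
    ← hφ.degree_eq_sum_deg_support hd]
  ring

/-- Complex points: `aeval w T = eval w (map ofReal T)`. [folklore] -/
theorem aeval_eq_eval_map (T : MvPolynomial (Fin 2) ℝ) (w : Fin 2 → ℂ) :
    MvPolynomial.aeval w T = MvPolynomial.eval w (MvPolynomial.map (algebraMap ℝ ℂ) T) := by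
  rw [MvPolynomial.aeval_def, MvPolynomial.eval_map]

/-! ## 2. Real polynomials whose complex roots lie in `{i, −i}` -/

/-- If `i` is a complex root of a real polynomial `τ`, then `X² + 1 ∣ τ`. [folklore] -/
theorem X_sq_add_one_dvd (τ : ℝ[X]) (h : Polynomial.aeval Complex.I τ = 0) : (X ^ 2 + 1 : ℝ[X]) ∣ τ := by
  have hI' : Polynomial.aeval (-Complex.I) τ = 0 := by
    rw [← Complex.conj_I, Polynomial.aeval_conj, h, map_zero]
  -- over `ℂ`: `(X − i)(X + i) ∣ τ_ℂ`
  set τc : ℂ[X] := τ.map (algebraMap ℝ ℂ) with hτc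
  have hroot : ∀ z : ℂ, Polynomial.aeval z τ = τc.eval z := fun z => by
    rw [hτc, Polynomial.eval_map, Polynomial.aeval_def]
  obtain ⟨g, hg⟩ : (X - C Complex.I) ∣ τc := Polynomial.dvd_iff_isRoot.2 (by rw [IsRoot.def, ← hroot]; exact h)
  have hg' : g.IsRoot (-Complex.I) := by
    have := hI'
    rw [hroot, hg, Polynomial.eval_mul, Polynomial.eval_sub, Polynomial.eval_X, Polynomial.eval_C] at this
    have hne : (-Complex.I - Complex.I) ≠ 0 := by
      rw [← neg_add', neg_ne_zero, ← two_mul]; exact mul_ne_zero two_ne_zero Complex.I_ne_zero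
    exact (mul_eq_zero.1 this).resolve_left hne
  obtain ⟨g', hg''⟩ := Polynomial.dvd_iff_isRoot.2 hg'
  have hdvdC : ((X ^ 2 + 1 : ℝ[X]).map (algebraMap ℝ ℂ)) ∣ τc := by
    refine ⟨g', ?_⟩
    rw [hg, hg'', Polynomial.map_add, Polynomial.map_pow, Polynomial.map_X, Polynomial.map_one, map_neg,
      ← mul_assoc]
    congr 1
    have hI2 : (C Complex.I : ℂ[X]) * C Complex.I = -1 := by
      rw [← map_mul, Complex.I_mul_I, map_neg, map_one]
    linear_combination (-1 : ℂ[X]) * hI2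
  have hmonic : (X ^ 2 + 1 : ℝ[X]).Monic := monic_X_pow_add_C 1 two_ne_zero
  exact (Polynomial.map_dvd_map (algebraMap ℝ ℂ) (algebraMap ℝ ℂ).injective hmonic).1 hdvdC

/-- A non-zero real polynomial all of whose complex roots lie in `{i, −i}` is `lc · (X² + 1)ᵃ`. [folklore] -/
theorem eq_C_mul_X_sq_add_one_pow (τ : ℝ[X]) (hτ : τ ≠ 0)
    (hroots : ∀ z : ℂ, Polynomial.aeval z τ = 0 → z = Complex.I ∨ z = -Complex.I) :
    ∃ a : ℕ, τ = C τ.leadingCoeff * (X ^ 2 + 1) ^ a := by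
  -- strong induction on the degree
  suffices H : ∀ (n : ℕ) (τ : ℝ[X]), τ.natDegree ≤ n → τ ≠ 0 →
      (∀ z : ℂ, Polynomial.aeval z τ = 0 → z = Complex.I ∨ z = -Complex.I) →
      ∃ a : ℕ, τ = C τ.leadingCoeff * (X ^ 2 + 1) ^ a from H _ τ le_rfl hτ hroots
  intro n
  induction n using Nat.strong_induction_on with
  | _ n IH =>
  intro τ hn hτ hroots
  by_cases hdeg : τ.natDegree = 0
  · exact ⟨0, by rw [pow_zero, mul_one, leadingCoeff, hdeg]; exact eq_C_of_natDegree_eq_zero hdeg⟩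
  -- a complex root exists, and it is `±i`; in both cases `i` is a root
  have hdegC : 0 < (τ.map (algebraMap ℝ ℂ)).degree := by
    rw [degree_map_eq_of_injective (algebraMap ℝ ℂ).injective]
    exact natDegree_pos_iff_degree_pos.1 (Nat.pos_of_ne_zero hdeg)
  obtain ⟨z, hz⟩ := Complex.exists_root hdegC
  have hz' : Polynomial.aeval z τ = 0 := by rw [Polynomial.aeval_def, ← Polynomial.eval_map]; exact hz
  have hI : Polynomial.aeval Complex.I τ = 0 := by
    rcases hroots z hz' with h | h
    · rw [← h]; exact hz'
    · have hconj : Complex.I = conj (-Complex.I) := by rw [map_neg, Complex.conj_I, neg_neg]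
      rw [hconj, Polynomial.aeval_conj, ← h, hz', map_zero]
  obtain ⟨τ', hτ'⟩ := X_sq_add_one_dvd τ hI
  have hmonic : (X ^ 2 + 1 : ℝ[X]).Monic := monic_X_pow_add_C 1 two_ne_zero
  have hτ'0 : τ' ≠ 0 := by rintro rfl; rw [mul_zero] at hτ'; exact hτ hτ'
  have hdeg' : τ'.natDegree < n := by
    have h1 : τ.natDegree = 2 + τ'.natDegree := by
      rw [hτ', hmonic.natDegree_mul' hτ'0, ← Polynomial.C_1, Polynomial.natDegree_X_pow_add_C]
    omega
  have hroots' : ∀ z : ℂ, Polynomial.aeval z τ' = 0 → z = Complex.I ∨ z = -Complex.I := by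
    intro z hz
    apply hroots
    rw [hτ', map_mul, hz, mul_zero]
  obtain ⟨a, ha⟩ := IH _ hdeg' τ' le_rfl hτ'0 hroots'
  refine ⟨a + 1, ?_⟩
  rw [hτ', leadingCoeff_monic_mul hmonic, pow_succ]
  conv_lhs => rw [ha]
  ring

/-! ## 3. The Möbius top-form lemma -/

/-- Two points agree iff their two coordinates agree (any codomain). [folklore] -/
theorem pt_ext₂ {α : Type*} {f g : Fin 2 → α} (h0 : f 0 = g 0) (h1 : f 1 = g 1) : f = g :=
  funext fun i => by fin_cases i; exacts [h0, h1]

/-- **Möbius top-form lemma** (m8; Step (2c) of the paper proof of 23124): a real binary form of degree `2k` with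
non-zero `x^{2k}`-coefficient, all of whose roots `t` of `T(t,1)` are purely imaginary, and which is invariant under the
rotation by `120°`, is `c·(x²+y²)^k`.  The statement is the body of `Helpers.MobiusTopForm` (HOME l15/Helpers23124b.lean)
verbatim. [folklore] -/
theorem mobiusTopForm :
    ∀ (k : ℕ) (T : MvPolynomial (Fin 2) ℝ), T.IsHomogeneous (2 * k) →
      MvPolynomial.coeff (Finsupp.single 0 (2 * k)) T ≠ 0 →
      (∀ t : ℂ, MvPolynomial.aeval (fun i : Fin 2 => if i = 0 then t else (1 : ℂ)) T = 0 → t.re = 0) →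
      (∀ v : Fin 2 → ℝ, MvPolynomial.eval
          (fun i => if i = 0 then -(1/2 : ℝ) * v 0 - (Real.sqrt 3 / 2) * v 1
            else (Real.sqrt 3 / 2) * v 0 - (1/2 : ℝ) * v 1) T
          = MvPolynomial.eval v T) →
      ∃ c : ℝ, ∀ v : Fin 2 → ℝ, MvPolynomial.eval v T = c * (v 0 ^ 2 + v 1 ^ 2) ^ k := by
  intro k T hhom hc₀ hre hρ
  have hs : Real.sqrt 3 * Real.sqrt 3 = 3 := Real.mul_self_sqrt (by norm_num)
  have hs0 : Real.sqrt 3 ≠ 0 := Real.sqrt_ne_zero'.2 (by norm_num)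
  -- (A) algebraic form of the rotation invariance; hence invariance at COMPLEX points
  set fρ : Fin 2 → MvPolynomial (Fin 2) ℝ := fun j => if j = 0 then
      MvPolynomial.C (-(1/2 : ℝ)) * MvPolynomial.X 0 - MvPolynomial.C (Real.sqrt 3 / 2) * MvPolynomial.X 1
    else MvPolynomial.C (Real.sqrt 3 / 2) * MvPolynomial.X 0 - MvPolynomial.C (1/2 : ℝ) * MvPolynomial.X 1 with hfρ
  have hbind : MvPolynomial.bind₁ fρ T = T := by
    apply MvPolynomial.funext
    intro v
    rw [eval_bind₁_eq]
    have hpt : (fun i => MvPolynomial.eval v (fρ i)) = fun i => if i = 0 then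
        -(1/2 : ℝ) * v 0 - (Real.sqrt 3 / 2) * v 1 else (Real.sqrt 3 / 2) * v 0 - (1/2 : ℝ) * v 1 :=
      pt_ext (by simp only [hfρ, if_true, map_sub, map_mul, MvPolynomial.eval_C, MvPolynomial.eval_X])
        (by simp only [hfρ, if_one_eq, map_sub, map_mul, MvPolynomial.eval_C, MvPolynomial.eval_X])
    rw [hpt]
    exact hρ v
  have hρC : ∀ w u : Fin 2 → ℂ, (fun i : Fin 2 => if i = 0 then
      ((-(1/2 : ℝ) : ℝ) : ℂ) * w 0 - ((Real.sqrt 3 / 2 : ℝ) : ℂ) * w 1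
      else ((Real.sqrt 3 / 2 : ℝ) : ℂ) * w 0 - ((1/2 : ℝ) : ℂ) * w 1) = u →
      MvPolynomial.aeval u T = MvPolynomial.aeval w T := by
    intro w u hu
    conv_rhs => rw [← hbind, MvPolynomial.aeval_bind₁]
    have hpt : (fun i => MvPolynomial.aeval w (fρ i)) = u := by
      rw [← hu]
      exact pt_ext₂
        (by simp only [hfρ, if_true, map_sub, map_mul, MvPolynomial.aeval_C, MvPolynomial.aeval_X,
          Complex.coe_algebraMap])
        (by simp only [hfρ, if_one_eq, map_sub, map_mul, MvPolynomial.aeval_C, MvPolynomial.aeval_X,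
          Complex.coe_algebraMap])
    rw [hpt]
  -- (B) the dehomogenised polynomial `τ(t) = T(t,1)` and its real / complex evaluations
  set τ : ℝ[X] := MvPolynomial.aeval (fun i : Fin 2 => if i = 0 then (X : ℝ[X]) else 1) T with hτ
  have hτC : ∀ z : ℂ, Polynomial.aeval z τ =
      MvPolynomial.aeval (fun i : Fin 2 => if i = 0 then z else (1 : ℂ)) T := by
    intro z
    rw [hτ, MvPolynomial.comp_aeval_apply]
    have hpt : (fun i : Fin 2 => Polynomial.aeval z ((fun j : Fin 2 => if j = 0 then (X : ℝ[X]) else 1) i)) =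
        fun i => if i = 0 then z else 1 :=
      pt_ext₂ (by simp only [if_true, Polynomial.aeval_X]) (by simp only [if_one_eq, map_one])
    rw [hpt]
  have hτR : ∀ x : ℝ, τ.eval x = MvPolynomial.eval (fun i : Fin 2 => if i = 0 then x else (1 : ℝ)) T := by
    intro x
    rw [hτ, ← Polynomial.coe_aeval_eq_eval, MvPolynomial.comp_aeval_apply, MvPolynomial.aeval_eq_eval]
    have hpt : (fun i : Fin 2 => Polynomial.aeval x ((fun j : Fin 2 => if j = 0 then (X : ℝ[X]) else 1) i)) =
        fun i => if i = 0 then x else 1 :=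
      pt_ext (by simp only [if_true, Polynomial.aeval_X]) (by simp only [if_one_eq, map_one])
    rw [hpt]
  -- degree bound `natDegree τ ≤ 2k` (compare with the `finSuccEquiv` picture)
  have hτdeg : τ.natDegree ≤ 2 * k := by
    set τ₁ : ℝ[X] := Polynomial.map (MvPolynomial.eval (fun _ : Fin 1 => (1 : ℝ)))
      (MvPolynomial.finSuccEquiv ℝ 1 T) with hτ₁
    have heq : τ = τ₁ := by
      apply Polynomial.funext
      intro x
      have hpt : (fun i : Fin 2 => if i = 0 then x else (1 : ℝ)) = Fin.cons x (fun _ : Fin 1 => (1 : ℝ)) := by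
        funext i
        fin_cases i <;> rfl
      rw [hτR, hτ₁, ← MvPolynomial.eval_eq_eval_mv_eval', hpt]
    rw [heq, hτ₁]
    exact Polynomial.natDegree_map_le.trans ((MvPolynomial.natDegree_finSuccEquiv T).le.trans
      ((MvPolynomial.degreeOf_le_totalDegree T 0).trans hhom.totalDegree_le))
  -- real scaling on `{y ≠ 0}`: `T(x,y) = y^{2k} τ(x/y)`
  have hscaleR : ∀ v : Fin 2 → ℝ, v 1 ≠ 0 → MvPolynomial.eval v T = v 1 ^ (2 * k) * τ.eval (v 0 / v 1) := by
    intro v hv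
    have hpt : v = v 1 • (fun i : Fin 2 => if i = 0 then v 0 / v 1 else (1 : ℝ)) :=
      pt_ext (by simp only [Pi.smul_apply, smul_eq_mul, if_true]; rw [← mul_div_assoc, mul_div_cancel_left₀ _ hv])
        (by simp only [Pi.smul_apply, smul_eq_mul, if_one_eq, mul_one])
    conv_lhs => rw [hpt]
    rw [eval_smul_of_isHomogeneous _ hhom, hτR]
  -- a polynomial agreeing with `T` on `{y ≠ 0}` equals `T`
  have hTeq : ∀ G : MvPolynomial (Fin 2) ℝ,
      (∀ v : Fin 2 → ℝ, v 1 ≠ 0 → MvPolynomial.eval v T = MvPolynomial.eval v G) → T = G := by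
    intro G hG
    apply MvPolynomial.funext_set (fun i : Fin 2 => if i = 0 then (Set.univ : Set ℝ) else {y | y ≠ 0})
    · intro i
      by_cases hi : i = 0
      · rw [if_pos hi]; exact Set.infinite_univ
      · rw [if_neg hi]; exact (Set.finite_singleton (0 : ℝ)).infinite_compl
    · intro v hv
      have hv1 : v 1 ∈ (fun i : Fin 2 => if i = 0 then (Set.univ : Set ℝ) else {y | y ≠ 0}) 1 :=
        hv 1 (Set.mem_univ _)
      simp only [if_one_eq, Set.mem_setOf_eq] at hv1
      exact hG v hv1
  -- (C) `τ ≠ 0`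
  have hτ0 : τ ≠ 0 := by
    intro h0
    have hT0 : T = 0 := hTeq 0 (fun v hv => by rw [hscaleR v hv, h0, Polynomial.eval_zero, mul_zero, map_zero])
    exact hc₀ (by rw [hT0, MvPolynomial.coeff_zero])
  -- (D) every complex root of `τ` is `±i`: the rotation moves the root `t` to the root `A/B`
  have hTc : (MvPolynomial.map (algebraMap ℝ ℂ) T).IsHomogeneous (2 * k) := hhom.map _
  have hrootsI : ∀ z : ℂ, Polynomial.aeval z τ = 0 → z = Complex.I ∨ z = -Complex.I := by
    intro z hz
    rw [hτC] at hz
    have hzre : z.re = 0 := hre z hz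
    set A : ℂ := ((-(1/2 : ℝ) : ℝ) : ℂ) * z - ((Real.sqrt 3 / 2 : ℝ) : ℂ) * 1 with hA
    set B : ℂ := ((Real.sqrt 3 / 2 : ℝ) : ℂ) * z - ((1/2 : ℝ) : ℂ) * 1 with hB
    have hrot : MvPolynomial.aeval (fun i : Fin 2 => if i = 0 then A else B) T = 0 := by
      have := hρC (fun i => if i = 0 then z else 1) (fun i => if i = 0 then A else B)
        (pt_ext₂ (by simp only [if_true, if_one_eq, hA]) (by simp only [if_true, if_one_eq, hB]))
      rw [hz] at this
      exact this
    have hAre : A.re = -(Real.sqrt 3 / 2) := by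
      simp only [hA, Complex.sub_re, Complex.mul_re, Complex.ofReal_re, Complex.ofReal_im, Complex.one_re,
        Complex.one_im, hzre]; ring
    have hAim : A.im = -(1/2 : ℝ) * z.im := by
      simp only [hA, Complex.sub_im, Complex.mul_im, Complex.ofReal_re, Complex.ofReal_im, Complex.one_re,
        Complex.one_im, hzre]; ring
    have hBre : B.re = -(1/2 : ℝ) := by
      simp only [hB, Complex.sub_re, Complex.mul_re, Complex.ofReal_re, Complex.ofReal_im, Complex.one_re,
        Complex.one_im, hzre]; ring
    have hBim : B.im = Real.sqrt 3 / 2 * z.im := by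
      simp only [hB, Complex.sub_im, Complex.mul_im, Complex.ofReal_re, Complex.ofReal_im, Complex.one_re,
        Complex.one_im, hzre]; ring
    have hB0 : B ≠ 0 := fun h => by rw [h, Complex.zero_re] at hBre; norm_num at hBre
    -- homogeneity: `T(A,B) = B^{2k} T(A/B, 1)`
    have hpt : (fun i : Fin 2 => if i = 0 then A else B) = B • (fun i : Fin 2 => if i = 0 then A / B else (1 : ℂ)) :=
      pt_ext₂ (by simp only [Pi.smul_apply, smul_eq_mul, if_true]; rw [← mul_div_assoc, mul_div_cancel_left₀ _ hB0])
        (by simp only [Pi.smul_apply, smul_eq_mul, if_one_eq, mul_one])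
    have hq : MvPolynomial.aeval (fun i : Fin 2 => if i = 0 then A / B else (1 : ℂ)) T = 0 := by
      have h1 := hrot
      rw [aeval_eq_eval_map, hpt, eval_smul_of_isHomogeneous _ hTc, ← aeval_eq_eval_map] at h1
      exact (mul_eq_zero.1 h1).resolve_left (pow_ne_zero _ hB0)
    have hqre : (A / B).re = 0 := hre _ hq
    rw [Complex.div_re, ← add_div] at hqre
    have hN : 0 < Complex.normSq B := Complex.normSq_pos.2 hB0
    have hnum : A.re * B.re + A.im * B.im = 0 := by
      rcases div_eq_zero_iff.1 hqre with h | h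
      · exact h
      · exact absurd h hN.ne'
    rw [hAre, hAim, hBre, hBim] at hnum
    have him : z.im * z.im = 1 := by
      have h3 : Real.sqrt 3 * (1 - z.im * z.im) = 0 := by linear_combination 4 * hnum
      rcases mul_eq_zero.1 h3 with h | h
      · exact absurd h hs0
      · linarith
    rcases mul_self_eq_one_iff.1 him with h1 | h1
    · left; apply Complex.ext <;> simp [hzre, h1]
    · right; apply Complex.ext <;> simp [hzre, h1]
  -- (E) `τ = lc · (X² + 1)^a` with `a ≤ k`
  obtain ⟨a, ha⟩ := eq_C_mul_X_sq_add_one_pow τ hτ0 hrootsI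
  have hlc : τ.leadingCoeff ≠ 0 := leadingCoeff_ne_zero.2 hτ0
  have hak : a ≤ k := by
    have h1 : τ.natDegree = 2 * a := by
      rw [ha, natDegree_C_mul hlc, natDegree_pow, ← Polynomial.C_1, Polynomial.natDegree_X_pow_add_C]; ring
    omega
  obtain ⟨m, hm⟩ : ∃ m : ℕ, 2 * k = m + 2 * a := ⟨2 * k - 2 * a, by omega⟩
  -- (F) `T = lc · y^m · (x² + y²)^a` as polynomials
  have hTG : T = MvPolynomial.C τ.leadingCoeff * MvPolynomial.X 1 ^ m *
      (MvPolynomial.X 0 ^ 2 + MvPolynomial.X 1 ^ 2) ^ a := by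
    refine hTeq _ fun v hv1 => ?_
    rw [hscaleR v hv1]
    conv_lhs => rw [ha]
    simp only [Polynomial.eval_mul, Polynomial.eval_C, Polynomial.eval_pow, Polynomial.eval_add,
      Polynomial.eval_X, Polynomial.eval_one, map_mul, map_pow, map_add, MvPolynomial.eval_C,
      MvPolynomial.eval_X]
    have hid : v 1 ^ 2 * ((v 0 / v 1) ^ 2 + 1) = v 0 ^ 2 + v 1 ^ 2 := by
      rw [mul_add, mul_one, div_pow, ← mul_div_assoc, mul_div_cancel_left₀ _ (pow_ne_zero 2 hv1)]
    rw [hm, pow_add, pow_mul, ← hid, mul_pow]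
    ring
  -- (G) `a = k`: otherwise the `x^{2k}`-coefficient of `T` would vanish
  have hm0 : m = 0 := by
    by_contra hm0
    obtain ⟨m', rfl⟩ : ∃ m', m = m' + 1 := ⟨m - 1, by omega⟩
    apply hc₀
    rw [hTG]
    have hfac : MvPolynomial.C τ.leadingCoeff * MvPolynomial.X 1 ^ (m' + 1) *
        (MvPolynomial.X 0 ^ 2 + MvPolynomial.X 1 ^ 2) ^ a =
        (MvPolynomial.C τ.leadingCoeff * MvPolynomial.X 1 ^ m' * (MvPolynomial.X 0 ^ 2 + MvPolynomial.X 1 ^ 2) ^ a) *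
          MvPolynomial.X (1 : Fin 2) := by ring
    rw [hfac, MvPolynomial.coeff_mul_X', if_neg]
    rw [Finsupp.mem_support_iff, Finsupp.single_apply, if_neg (by decide : ¬ ((0 : Fin 2) = 1))]
    exact fun h => h rfl
  have hak' : a = k := by omega
  subst hak'
  refine ⟨τ.leadingCoeff, fun v => ?_⟩
  rw [hTG, hm0]
  simp only [pow_zero, mul_one, map_mul, map_pow, map_add, MvPolynomial.eval_C, MvPolynomial.eval_X]

end Summit.QuantumFields.YangMills.Theorems.RationalShortRootRigidity
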